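import Summits.Ventures.Crystal3D.Theorems.StickyWulffConstantGenericWallFloorHStarTransport
import Summits.Ventures.Crystal3D.Theorems.StickyWulffConstantGenericWallFloorCapStartBarlowStep
import Literature.Algebra.EuclideanLattices.FccBccLattices
import HarnessLib

/-!
# The equatorial hcp star is NOT exact-only: `¬ ExactOnly 0 (hStar u₀)` by an explicit rational twelve-ball completion; hence `¬ HStarModel`
# (crux `GenericWallFloor`, stmt-Ventures-19480; kills lane T's registered input `stub_E1h` of `TexShadow` v8.15–v8.19; 19480-p1 g18, 2026-08-29)

HONEST FRAMING. Venture `Summits/Ventures/Crystal3D` (cell `crystal3d-full`), route `route-Ventures-StickyWulffConstant`, helper for the crux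
`GenericWallFloor` (stmt-Ventures-19480) / consumer `TextureLiminfV5` (stmt-Ventures-23912).  Standard axioms; every check is rational arithmetic in the
kernel (`decide` / `norm_num`).  It REFUTES the statement registered as `stub_E1h : ∀ u₀ ∈ fccSlots, u₀ 2 = 0 → ExactOnly 0 (hStar u₀)` (…HStarTransport,
«E1h in model form», the intended certified computation «A12-583») and with it `HStarModel`; the LAYER ROWS derivation R1′ of lane T
(`hStarModel_of_exactOnly stub_E1h`) therefore rests on a false input and needs a deficiency / junk row for the equatorial star instead.  F-C1 not moved.

THE WITNESS (found numerically, kit j333500; made exact by hand).  Write `enc (r₁, r₂, r₃) := (r₁, r₂√3, r₃√(2/3))`, so `⟪enc r, enc s⟫ = r₁s₁ + 3r₂s₂ + (2/3)r₃s₃`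
is rational.  For the in-plane slot `u₀ = (1,0,0) = barlowPos 0 1 0`, `hStar u₀` = the five h-slots with negative first coordinate:
`enc(−1,0,0), enc(−½,−½,0), enc(−½,½,0), enc(−½,⅙,1), enc(−½,⅙,−1)` (the arrival slot `−u₀`, its two hexagon neighbours, the upper slot of triple
`(1,−1,0)` and its basal mirror — the eclipsed pair).  The twelve unit vectors
`hStar u₀ ∪ {enc(½,−½,0), enc(0,−⅓,1), enc(0,−⅓,−1)} ∪ {enc(5/6,−1/18,±2/3), enc(⅓,4/9,±2/3)}`
are pairwise at `cos ≤ ½` (17 contacts) — a KISSING completion of `hStar u₀` — and contain the pair `enc(5/6,−1/18,2/3)`, `enc(−½,⅙,−1)` at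
`cos = −5/12 − 1/36 − 4/9 = −8/9`, a value no two members of an fcc dozen (`±1, ±½, 0`) or of an hcp dozen (`×18 ∈ {9,0,−9,−18,−6,−15}`) subtend; so
the completion is NOT a close-packed dozen.  Geometrically: the eclipsed TRIANGLE PAIR on the hexagon edge `u₀ — (½,√3/2,0)` (four slots) is replaced by
a basal-mirror-symmetric twisted quadruple — the anticuboctahedron's analogue of the cuboctahedron's twisted square; P₅ (and the hcp POLAR star, which
IS P₅) stay exact-only (E1).
* `inner_ne_neg_eight_ninths_fcc/hcp`, `not_closePacked_of_inner_eq` — no close-packed dozen has a pair at `cos = −8/9`;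
* `enc`, `inner_enc` — the rational encoding; `e1hWitnessQ`, `e1hWitness`, `card_e1hWitness`, `isKissingAround_e1hWitness`, `not_closePacked_e1hWitness`;
* `hStar_u₀_subset_e1hWitness` — the five equatorial-star slots are in the witness (slot-triple enumeration as in …HRowEndFarRefuted);
* **`not_exactOnly_hStar_u₀`**, **`not_stub_E1h`** (`¬ ∀ u₀ ∈ fccSlots, u₀ 2 = 0 → ExactOnly 0 (hStar u₀)`), **`not_hStarModel`**.
WHAT THIS IS NOT: a statement about configurations with more structure (the walker's actual arrival context may certify more than `hStar`); F-C1 not moved.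
-/

noncomputable section

namespace Summit.Ventures.Crystal3D.Theorems

open Finset
open Literature.MathematicalPhysics.StatisticalMechanics (barlowPos constHagg haggLabel_const barlowPos_apply_zero barlowPos_apply_one
  barlowPos_apply_two basalMirror basalMirror_apply_coord)
open Literature.Geometry.DiscreteGeometry
open Literature.Algebra.EuclideanLattices (inner_fin_three)
open scoped InnerProductSpace

/-! ### No close-packed dozen has a pair at `cos = −8/9` -/

/-- The inner product of two integer vectors, in coordinates. -/
private theorem inner_intVec_intVec' (v w : Fin 3 → ℤ) :
    ⟪intVec v, intVec w⟫_ℝ = ((v 0 * w 0 + v 1 * w 1 + v 2 * w 2 : ℤ) : ℝ) := by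
  simp [intVec, PiLp.inner_apply, Fin.sum_univ_three, mul_comm]

/-- fcc: `⟪p, q⟫ = (v·w)/2` with `v·w ∈ ℤ` is never `−8/9`. -/
theorem inner_ne_neg_eight_ninths_fcc {p q : EuclideanSpace ℝ (Fin 3)} (hp : p ∈ fccKissingPattern) (hq : q ∈ fccKissingPattern) :
    ⟪p, q⟫_ℝ ≠ -8 / 9 := by
  obtain ⟨v, -, rfl⟩ := Finset.mem_image.1 hp
  obtain ⟨w, -, rfl⟩ := Finset.mem_image.1 hq
  rw [real_inner_smul_left, real_inner_smul_right, inner_intVec_intVec']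
  have hs2 : Real.sqrt (2 : ℕ) * Real.sqrt (2 : ℕ) = 2 := Real.mul_self_sqrt (by norm_num)
  intro h
  set k : ℤ := v 0 * w 0 + v 1 * w 1 + v 2 * w 2 with hk
  have h2 : (k : ℝ) = -8 / 9 * (Real.sqrt (2 : ℕ) * Real.sqrt (2 : ℕ)) := by
    field_simp at h; field_simp; linarith
  rw [hs2] at h2
  have h3 : ((9 * k : ℤ) : ℝ) = -16 := by push_cast; linarith
  have h4 : (9 * k : ℤ) = -16 := by exact_mod_cast h3
  omega

/-- hcp: `⟪p, q⟫ = (v·w)/18` and no pair of `hcpInt` has `v·w = −16`. -/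
theorem inner_ne_neg_eight_ninths_hcp {p q : EuclideanSpace ℝ (Fin 3)} (hp : p ∈ hcpKissingPattern) (hq : q ∈ hcpKissingPattern) :
    ⟪p, q⟫_ℝ ≠ -8 / 9 := by
  obtain ⟨v, hv, rfl⟩ := Finset.mem_image.1 hp
  obtain ⟨w, hw, rfl⟩ := Finset.mem_image.1 hq
  rw [real_inner_smul_left, real_inner_smul_right, inner_intVec_intVec']
  have hs18 : Real.sqrt (18 : ℕ) * Real.sqrt (18 : ℕ) = 18 := Real.mul_self_sqrt (by norm_num)
  intro h
  set k : ℤ := v 0 * w 0 + v 1 * w 1 + v 2 * w 2 with hk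
  have h2 : (k : ℝ) = -8 / 9 * (Real.sqrt (18 : ℕ) * Real.sqrt (18 : ℕ)) := by
    field_simp at h; field_simp; linarith
  rw [hs18] at h2
  have h3 : k = -16 := by
    have : (k : ℝ) = -16 := by rw [h2]; norm_num
    exact_mod_cast this
  have key : ∀ v ∈ hcpInt, ∀ w ∈ hcpInt, v 0 * w 0 + v 1 * w 1 + v 2 * w 2 ≠ -16 := by decide
  exact key v hv w hw (by rw [← hk]; exact h3)

/-- **A close-packed dozen around `c` has no two members at `cos = −8/9` from `c`.** -/
theorem not_closePacked_of_inner_eq {c : EuclideanSpace ℝ (Fin 3)} {D : Finset (EuclideanSpace ℝ (Fin 3))}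
    (hD : IsClosePackedDozenAt c D) {d₁ d₂ : EuclideanSpace ℝ (Fin 3)} (h₁ : d₁ ∈ D) (h₂ : d₂ ∈ D)
    (h : ⟪d₁ - c, d₂ - c⟫_ℝ = -8 / 9) : False := by
  obtain ⟨A, hA | hA⟩ := hD
  · have h₁' : d₁ ∈ (fun p => A p + c) '' (↑fccKissingPattern : Set _) := by rw [← hA]; exact Finset.mem_coe.2 h₁
    have h₂' : d₂ ∈ (fun p => A p + c) '' (↑fccKissingPattern : Set _) := by rw [← hA]; exact Finset.mem_coe.2 h₂
    obtain ⟨p, hp, rfl⟩ := h₁'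
    obtain ⟨q, hq, rfl⟩ := h₂'
    simp only [add_sub_cancel_right, LinearIsometry.inner_map_map] at h
    exact inner_ne_neg_eight_ninths_fcc (Finset.mem_coe.1 hp) (Finset.mem_coe.1 hq) h
  · have h₁' : d₁ ∈ (fun p => A p + c) '' (↑hcpKissingPattern : Set _) := by rw [← hA]; exact Finset.mem_coe.2 h₁
    have h₂' : d₂ ∈ (fun p => A p + c) '' (↑hcpKissingPattern : Set _) := by rw [← hA]; exact Finset.mem_coe.2 h₂
    obtain ⟨p, hp, rfl⟩ := h₁'
    obtain ⟨q, hq, rfl⟩ := h₂'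
    simp only [add_sub_cancel_right, LinearIsometry.inner_map_map] at h
    exact inner_ne_neg_eight_ninths_hcp (Finset.mem_coe.1 hp) (Finset.mem_coe.1 hq) h

/-! ### The rational encoding `(r₁, r₂√3, r₃√(2/3))` -/

/-- The model vector with coordinates `(z₁/18, (z₂/18)√3, (z₃/18)√(2/3))` for an integer triple `z` (denominators cleared by `18`). -/
def enc (z : ℤ × ℤ × ℤ) : EuclideanSpace ℝ (Fin 3) :=
  !₂[(z.1 : ℝ) / 18, (z.2.1 : ℝ) / 18 * Real.sqrt 3, (z.2.2 : ℝ) / 18 * Real.sqrt (2 / 3)]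

/-- The INTEGER bilinear form computing inner products of encoded vectors: `⟪enc z, enc w⟫ = encForm z w / 972`. -/
def encForm (z w : ℤ × ℤ × ℤ) : ℤ := 3 * (z.1 * w.1) + 9 * (z.2.1 * w.2.1) + 2 * (z.2.2 * w.2.2)

/-- First coordinate of `enc`. -/
@[simp] theorem enc_apply_zero (z : ℤ × ℤ × ℤ) : enc z 0 = (z.1 : ℝ) / 18 := by simp [enc]
/-- Second coordinate of `enc`. -/
@[simp] theorem enc_apply_one (z : ℤ × ℤ × ℤ) : enc z 1 = (z.2.1 : ℝ) / 18 * Real.sqrt 3 := by simp [enc]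
/-- Third coordinate of `enc`. -/
@[simp] theorem enc_apply_two (z : ℤ × ℤ × ℤ) : enc z 2 = (z.2.2 : ℝ) / 18 * Real.sqrt (2 / 3) := by simp [enc]

/-- **Inner products of encoded vectors are rational**: `⟪enc z, enc w⟫ = encForm z w / 972`. -/
theorem inner_enc (z w : ℤ × ℤ × ℤ) : ⟪enc z, enc w⟫_ℝ = ((encForm z w : ℤ) : ℝ) / 972 := by
  have h3 : Real.sqrt 3 * Real.sqrt 3 = 3 := Real.mul_self_sqrt (by norm_num)
  have h23 : Real.sqrt (2 / 3) * Real.sqrt (2 / 3) = 2 / 3 := Real.mul_self_sqrt (by norm_num)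
  rw [inner_fin_three, enc_apply_zero, enc_apply_zero, enc_apply_one, enc_apply_one, enc_apply_two, enc_apply_two, encForm]
  push_cast
  have e1 : ((z.2.1 : ℝ) / 18 * Real.sqrt 3) * ((w.2.1 : ℝ) / 18 * Real.sqrt 3) = 3 * ((z.2.1 : ℝ) * w.2.1) / 324 := by
    rw [mul_mul_mul_comm, h3]; ring
  have e2 : ((z.2.2 : ℝ) / 18 * Real.sqrt (2 / 3)) * ((w.2.2 : ℝ) / 18 * Real.sqrt (2 / 3)) = 2 / 3 * ((z.2.2 : ℝ) * w.2.2) / 324 := by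
    rw [mul_mul_mul_comm, h23]; ring
  rw [e1, e2]; ring

/-- `enc` is injective. -/
theorem enc_injective : Function.Injective enc := by
  intro r s h
  have h0 := congrArg (fun x : EuclideanSpace ℝ (Fin 3) => x 0) h
  have h1 := congrArg (fun x : EuclideanSpace ℝ (Fin 3) => x 1) h
  have h2 := congrArg (fun x : EuclideanSpace ℝ (Fin 3) => x 2) h
  simp only [enc_apply_zero, enc_apply_one, enc_apply_two] at h0 h1 h2
  have hs3 : (0 : ℝ) < Real.sqrt 3 := Real.sqrt_pos.2 (by norm_num)
  have hs23 : (0 : ℝ) < Real.sqrt (2 / 3) := Real.sqrt_pos.2 (by norm_num)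
  have h1' : (r.2.1 : ℝ) / 18 = (s.2.1 : ℝ) / 18 := mul_right_cancel₀ hs3.ne' h1
  have h2' : (r.2.2 : ℝ) / 18 = (s.2.2 : ℝ) / 18 := mul_right_cancel₀ hs23.ne' h2
  have e0 : (r.1 : ℝ) = s.1 := by linarith
  have e1 : (r.2.1 : ℝ) = s.2.1 := by linarith
  have e2 : (r.2.2 : ℝ) = s.2.2 := by linarith
  refine Prod.ext (by exact_mod_cast e0) (Prod.ext (by exact_mod_cast e1) (by exact_mod_cast e2))

/-! ### The witness -/

/-- The twelve coordinate triples of the witness, `×18` (first five = `hStar u₀`; then three more h-slots; then the twisted quadruple). -/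
def e1hWitnessQ : Finset (ℤ × ℤ × ℤ) :=
  {(-18, 0, 0), (-9, -9, 0), (-9, 9, 0), (-9, 3, 18), (-9, 3, -18),
   (9, -9, 0), (0, -6, 18), (0, -6, -18),
   (15, -1, 12), (15, -1, -12), (6, 8, 12), (6, 8, -12)}

/-- **The witness**: a twelve-ball kissing completion of the equatorial star that is not close-packed. -/
def e1hWitness : Finset (EuclideanSpace ℝ (Fin 3)) := e1hWitnessQ.image enc

/-- Twelve balls. -/
theorem card_e1hWitness : e1hWitness.card = 12 := by
  rw [e1hWitness, card_image_of_injective _ enc_injective]; decide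

/-- The rational checks: unit norms, pairwise `cos ≤ ½`. -/
theorem e1hWitnessQ_checks :
    (∀ r ∈ e1hWitnessQ, encForm r r = 972) ∧ (∀ r ∈ e1hWitnessQ, ∀ s ∈ e1hWitnessQ, r ≠ s → encForm r s ≤ 486) := by
  constructor <;> decide

/-- **The witness is a kissing arrangement around `0`.** -/
theorem isKissingAround_e1hWitness : IsKissingAround 0 e1hWitness := by
  classical
  refine ⟨fun x hx => ?_, fun x hx y hy hxy => ?_⟩
  · obtain ⟨r, hr, rfl⟩ := Finset.mem_image.1 hx
    have h1 : ‖enc r‖ ^ 2 = 1 := by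
      rw [← real_inner_self_eq_norm_sq, inner_enc, e1hWitnessQ_checks.1 r hr]; norm_num
    rw [dist_comm, dist_eq_norm, sub_zero]
    nlinarith [norm_nonneg (enc r)]
  · obtain ⟨r, hr, rfl⟩ := Finset.mem_image.1 hx
    obtain ⟨s, hs, rfl⟩ := Finset.mem_image.1 hy
    have hrs : r ≠ s := fun e => hxy (by rw [e])
    have hle : ⟪enc r, enc s⟫_ℝ ≤ 1 / 2 := by
      rw [inner_enc]
      have : ((encForm r s : ℤ) : ℝ) ≤ 486 := by exact_mod_cast e1hWitnessQ_checks.2 r hr s hs hrs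
      linarith
    have hr1 : ‖enc r‖ ^ 2 = 1 := by
      rw [← real_inner_self_eq_norm_sq, inner_enc, e1hWitnessQ_checks.1 r hr]; norm_num
    have hs1 : ‖enc s‖ ^ 2 = 1 := by
      rw [← real_inner_self_eq_norm_sq, inner_enc, e1hWitnessQ_checks.1 s hs]; norm_num
    have hd : 1 ≤ ‖enc r - enc s‖ ^ 2 := by rw [norm_sub_sq_real, hr1, hs1]; linarith
    rw [dist_eq_norm]
    nlinarith [norm_nonneg (enc r - enc s)]

/-- **The witness is not a close-packed dozen** (it has a pair at `cos = −8/9`). -/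
theorem not_closePacked_e1hWitness : ¬ IsClosePackedDozenAt 0 e1hWitness := by
  intro hD
  have h₁ : enc (15, -1, 12) ∈ e1hWitness := Finset.mem_image_of_mem _ (by decide)
  have h₂ : enc (-9, 3, -18) ∈ e1hWitness := Finset.mem_image_of_mem _ (by decide)
  refine not_closePacked_of_inner_eq hD h₁ h₂ ?_
  rw [sub_zero, sub_zero, inner_enc]
  norm_num [encForm]

/-! ### The equatorial star of `u₀ = (1, 0, 0)` lies in the witness -/

/-- The in-plane slot `u₀ = (1, 0, 0)`. -/
def hStarU₀ : EuclideanSpace ℝ (Fin 3) := barlowPos 1 (Real.sqrt (2 / 3)) constHagg 0 1 0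

/-- `u₀` is a slot. -/
theorem hStarU₀_mem : hStarU₀ ∈ fccSlots := by
  rw [hStarU₀, fccSlots, mem_image]; exact ⟨(0, 1, 0), by simp [fccSlotTriples], rfl⟩

/-- Coordinates of `u₀`: `(1, 0, 0)`. -/
theorem hStarU₀_apply : hStarU₀ 0 = 1 ∧ hStarU₀ 1 = 0 ∧ hStarU₀ 2 = 0 := by
  refine ⟨?_, ?_, ?_⟩ <;> simp [hStarU₀]

/-- `⟪s, −u₀⟫ = −s₀`. -/
theorem inner_neg_hStarU₀ (s : EuclideanSpace ℝ (Fin 3)) : ⟪s, -hStarU₀⟫_ℝ = -(s 0) := by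
  rw [inner_neg_right, inner_fin_three, hStarU₀_apply.1, hStarU₀_apply.2.1, hStarU₀_apply.2.2]; ring

/-- Every slot is `barlowPos` of a listed triple. -/
private theorem slot_cases' {w : EuclideanSpace ℝ (Fin 3)} (hw : w ∈ fccSlots) :
    ∃ c ∈ fccSlotTriples, w = barlowPos 1 (Real.sqrt (2 / 3)) constHagg c.1 c.2.1 c.2.2 := by
  rw [fccSlots, mem_image] at hw
  obtain ⟨c, hc, rfl⟩ := hw
  exact ⟨c, hc, rfl⟩

/-- **The upper slots with negative first coordinate** are the four slots of triples `(0,−1,0), (0,0,−1), (0,−1,1), (1,−1,0)`, i.e.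
`(−1,0,0), (−½,−√3/2,0), (−½,√3/2,0), (−½,√3/6,√(2/3))` = `enc` of `(−18,0,0), (−9,−9,0), (−9,9,0), (−9,3,18)`. -/
theorem upper_slot_neg_cases {w : EuclideanSpace ℝ (Fin 3)} (hw : w ∈ fccSlots) (h2 : 0 ≤ w 2) (h0 : w 0 < 0) :
    w = enc (-18, 0, 0) ∨ w = enc (-9, -9, 0) ∨ w = enc (-9, 9, 0) ∨ w = enc (-9, 3, 18) := by
  obtain ⟨c, hc, rfl⟩ := slot_cases' hw
  have hs : 0 < Real.sqrt (2 / 3) := Real.sqrt_pos.2 (by norm_num)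
  simp only [fccSlotTriples, mem_insert, mem_singleton] at hc
  rcases hc with rfl | rfl | rfl | rfl | rfl | rfl | rfl | rfl | rfl | rfl | rfl | rfl <;>
    simp only [barlowPos_apply_zero, barlowPos_apply_two, haggLabel_const] at h0 h2 <;> push_cast at h0 h2
  · exfalso; linarith
  · exfalso; linarith
  · exfalso; linarith
  · exfalso; linarith
  · exfalso; linarith
  · exfalso; linarith
  · left; ext t; fin_cases t <;> simp
  · right; left; ext t; fin_cases t <;> simp <;> ring
  · exfalso; nlinarith
  · right; right; left; ext t; fin_cases t <;> simp <;> ring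
  · right; right; right; ext t; fin_cases t <;> simp <;> ring
  · exfalso; linarith

/-- **`hStar u₀ ⊆` the witness.** -/
theorem hStar_u₀_subset_e1hWitness : hStar hStarU₀ ⊆ e1hWitness := by
  classical
  intro s hs
  rw [hStar_eq, mem_filter] at hs
  obtain ⟨hsh, hpos⟩ := hs
  rw [inner_neg_hStarU₀] at hpos
  have h0 : s 0 < 0 := by linarith
  have memQ : ∀ r : ℤ × ℤ × ℤ, r ∈ e1hWitnessQ → enc r ∈ e1hWitness := fun r hr => Finset.mem_image_of_mem _ hr
  rcases mem_hcpSlots.1 hsh with ⟨hs', hs2⟩ | ⟨t, ⟨ht, ht2⟩, rfl⟩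
  · rcases upper_slot_neg_cases hs' hs2 h0 with rfl | rfl | rfl | rfl <;> exact memQ _ (by decide)
  · have ht0 : t 0 < 0 := by rw [basalMirror_apply_coord] at h0; simpa using h0
    rcases upper_slot_neg_cases ht ht2 ht0 with rfl | rfl | rfl | rfl
    · rw [basalMirror_of_inPlane (by simp)]; exact memQ _ (by decide)
    · rw [basalMirror_of_inPlane (by simp)]; exact memQ _ (by decide)
    · rw [basalMirror_of_inPlane (by simp)]; exact memQ _ (by decide)
    · have e : basalMirror (enc (-9, 3, 18)) = enc (-9, 3, -18) := by
        ext t; rw [basalMirror_apply_coord]; fin_cases t <;> simp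
      rw [e]; exact memQ _ (by decide)

/-! ### The refutation -/

/-- **THE EQUATORIAL hcp STAR IS NOT EXACT-ONLY**: `¬ ExactOnly 0 (hStar (1,0,0))`. -/
theorem not_exactOnly_hStar_u₀ : ¬ ExactOnly 0 (hStar hStarU₀) := fun h =>
  not_closePacked_e1hWitness (h e1hWitness hStar_u₀_subset_e1hWitness card_e1hWitness isKissingAround_e1hWitness)

/-- **`stub_E1h` AS STATED IS FALSE**: not every in-plane slot's equatorial closed star is exact-only. -/
theorem not_stub_E1h : ¬ (∀ u₀ ∈ fccSlots, u₀ 2 = 0 → ExactOnly 0 (hStar u₀)) := fun h =>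
  not_exactOnly_hStar_u₀ (h hStarU₀ hStarU₀_mem hStarU₀_apply.2.2)

/-- **`HStarModel` IS FALSE.** -/
theorem not_hStarModel : ¬ HStarModel := fun h =>
  not_exactOnly_hStar_u₀ (h hStarU₀ hStarU₀_mem hStarU₀_apply.2.2).1

end Summit.Ventures.Crystal3D.Theorems

end
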